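import Mathlib
import HarnessLib
import Literature.Analysis.FluidPDE.SelfSimilar
import Literature.Analysis.FluidPDE.LocalTypeI
import Literature.Analysis.FluidPDE.VectorCalculus
import Literature.Analysis.FluidPDE.VanishingVerticalVorticityPotentials
import Literature.Analysis.FluidPDE.VanishingVerticalVorticityPotentialsTime
import Literature.Analysis.FluidPDE.TaoEnstrophyLocalisation
import Literature.Analysis.UnboundedOperators.HeatKernel
import Summits.NavierStokesRegularity.NavierStokesRegularity.Theorems.LocalSineTubeDoorProfileAlignedWindowRigidityAncient

/-!
# Route `PoloidalWindowDoor` (staged, nsreg-p1), crux `PoloidalWindowRigidity` (K2) — Clebsch variables for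
# the open stub `stub_nonflatLiouville` (branch (G): non-flat poloidal Type-I profiles)

Cell ns-regularity-ideate, seat p7 (lead on K2; route-directed support, to be landed
`--supports <PoloidalWindowRigidity item>` once the route is born). The five-stub birth skeleton
(`route-poloidal/bc/PoloidalWindowRigidity_birth.lean`) is closed modulo ONE stub, `stub_nonflatLiouville`,
by seat p6's files; this file is the base camp for that stub. Under EXACTLY the stub's hypotheses — the
route's Type-I profile class (rate `‖v(t,x)‖ ≤ C/√(−t)`, continuity on the open slab, unit-viscosity
Oseen-mild identity, divergence-free slices) and poloidality along `e₂`, `⟪curl v(s), e₂⟫ ≡ 0` — every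
slice `v s`, `s < 0`, is smooth (`contDiff_slice`, joint real-analyticity of Oseen-ancient fields) and is
written in the CLEBSCH / purely-POLOIDAL form of the tree file
`Literature/Analysis/FluidPDE/VanishingVerticalVorticityPotentials.lean`:

* `exists_clebsch_slice` — for every `s < 0` there are smooth `φ ψ : ℝ³ → ℝ` with `v s = ∇φ + ψ e₂`,
  `∂₀φ = v₀`, `∂₁φ = v₁`, `v₂ = ∂₂φ + ψ`, `curl (v s) = ∇ψ × e₂` (`(curl v)₀ = ∂₁ψ`, `(curl v)₁ = −∂₀ψ`:
  the vortex lines are the level curves of `ψ` in the horizontal planes) and the incompressibility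
  constraint **(E1) `Δφ + ∂₂ψ = 0`**;
* `frozen_bracket` — the FROZEN CONSTRAINT of the skeleton (stub `stub_firstIntegral`, nsreg-p1 R8-b:
  `⟪D(v s)·curl(v s), e₂⟫ ≡ 0`, `v₂` is a first integral of the vortex lines) in Clebsch form: the planar
  Poisson bracket vanishes, **`{ψ, v₂}_h = ∂₁ψ ∂₀v₂ − ∂₀ψ ∂₁v₂ = 0`**, i.e. `∇_h v₂ ∥ ∇_h ψ` — on each
  horizontal plane `v₂` and `ψ` are functionally dependent;
* `curl_two_eq_zero` — `⟪curl v(s) y, e₂⟫ = 0 ↔ (curl v(s) y)₂ = 0` bookkeeping;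
* `exists_clebsch_uncurry` — a TIME-DEPENDENT choice: `φ, ψ : ℝ → ℝ³ → ℝ` jointly smooth on the open slab
  `(−∞,0) × ℝ³` (tree `VerticalVorticityFree.contDiffOn_linePotential_uncurry`) with the slice identities
  `v t = ∇(φ t) + (ψ t) e₂`, `curl (v t) = ∇(ψ t) × e₂`, (E1) for every `t < 0` — the form in which the
  evolution equations of the cell analysis (`∂ₜψ + v·∇ψ − Δψ = T`, `∇T × e₂ = ∇v₂ × ∇ψ`) are to be written.

The open content of the stub (nsreg-p1 ROUND-8/9, branch (G)) is untouched: in these variables the momentum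
equation reads `∇B + T e₂ = v₂ ∇ψ` with `B = ∂ₜφ + p + |v|²/2 − Δφ`, `T = ∂ₜψ + v·∇ψ − Δψ` (cell analysis,
not formalised here), and no signed quantity is known on the rotational non-flat stratum.

WHAT THIS IS NOT: not a claim about Navier–Stokes regularity and not a proof of K2 — kernel bookkeeping for a
STAGED door route's open stub (bears_on LADDER-NS N0, rung N0-LocalTubeDoorPoloidal).
-/

noncomputable section

-- the summit and its single sub-problem share the name (CONVENTIONS §1), as in every Theorems file
set_option linter.dupNamespace false

namespace Summit.NavierStokesRegularity.NavierStokesRegularity.Theorems.PoloidalWindowDoorPoloidalWindowRigidityClebsch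

open MeasureTheory Set Function Filter Topology TopologicalSpace Metric
open scoped RealInnerProductSpace InnerProductSpace Laplacian ContDiff
open Literature.Analysis Literature.Analysis.FluidPDE
open Literature.Analysis.FluidPDE.VerticalVorticityFree
open Summit.NavierStokesRegularity.NavierStokesRegularity.Theorems.LocalSineTubeDoorProfileAlignedWindowRigidityAncient

variable {C : ℝ} {v : ℝ → EuclideanSpace ℝ (Fin 3) → EuclideanSpace ℝ (Fin 3)}

/-- **Slices of a profile of the route's class are smooth** (joint real-analyticity of Oseen-ancient fields,
`…Ancient.analyticOnNhd_slice`, with the Type-I rate supplying boundedness on sub-slabs). -/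
theorem contDiff_slice (hrate : HasTypeITimeDecay C v)
    (hcont : ContinuousOn (uncurry v) (Iio (0 : ℝ) ×ˢ univ))
    (hmild : ∀ s t : ℝ, s < t → t < 0 → ∀ x,
      v t x = UnboundedOperators.heatExtension (v s) (t - s) x - oseenDuhamel 1 s v v t x)
    {s : ℝ} (hs : s < 0) : ContDiff ℝ ∞ (v s) := by
  have han := analyticOnNhd_slice hcont (bdd_of_hasTypeITimeDecay hrate) hmild hs
  exact contDiffOn_univ.1 han.contDiffOn_of_completeSpace

/-- Bookkeeping: `⟪w, e₂⟫ = w₂`, so poloidality along `e₂` is the vanishing of the vertical coordinate of the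
curl. -/
theorem curl_two_eq_zero
    (hpol : ∀ s < 0, ∀ y, ⟪curl (v s) y, EuclideanSpace.single 2 1⟫_ℝ = 0)
    {s : ℝ} (hs : s < 0) (y : EuclideanSpace ℝ (Fin 3)) : curl (v s) y 2 = 0 := by
  have h := hpol s hs y
  simp only [EuclideanSpace.inner_single_right, one_mul, conj_trivial] at h
  exact h

/-- **Clebsch (purely poloidal) form of the slices.** Under the hypotheses of `stub_nonflatLiouville` (class +
poloidality along `e₂`), every slice `v s`, `s < 0`, is `∇φ + ψ e₂` with smooth `φ, ψ`, `∂₀φ = v₀`,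
`∂₁φ = v₁`, `v₂ = ∂₂φ + ψ`, `curl (v s) = ∇ψ × e₂` (coordinates `(∂₁ψ, −∂₀ψ, 0)`), and the
incompressibility constraint (E1) `Δφ + ∂₂ψ = 0` (tree `VerticalVorticityFree.exists_potential_add_vertical`
applied to the smooth, divergence-free, vertically-curl-free slice). -/
theorem exists_clebsch_slice (hrate : HasTypeITimeDecay C v)
    (hcont : ContinuousOn (uncurry v) (Iio (0 : ℝ) ×ˢ univ))
    (hmild : ∀ s t : ℝ, s < t → t < 0 → ∀ x,
      v t x = UnboundedOperators.heatExtension (v s) (t - s) x - oseenDuhamel 1 s v v t x)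
    (hdiv : ∀ t < 0, VectorCalculus.IsDivFree (v t))
    (hpol : ∀ s < 0, ∀ y, ⟪curl (v s) y, EuclideanSpace.single 2 1⟫_ℝ = 0)
    {s : ℝ} (hs : s < 0) :
    ∃ φ ψ : EuclideanSpace ℝ (Fin 3) → ℝ, ContDiff ℝ ∞ φ ∧ ContDiff ℝ ∞ ψ ∧
      (∀ y, fderiv ℝ φ y (EuclideanSpace.single 0 1) = v s y 0) ∧
      (∀ y, fderiv ℝ φ y (EuclideanSpace.single 1 1) = v s y 1) ∧
      (∀ y, v s y 2 = fderiv ℝ φ y (EuclideanSpace.single 2 1) + ψ y) ∧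
      (∀ y, v s y = gradient φ y + ψ y • EuclideanSpace.single 2 1) ∧
      (∀ y, curl (v s) y 0 = fderiv ℝ ψ y (EuclideanSpace.single 1 1) ∧
        curl (v s) y 1 = -fderiv ℝ ψ y (EuclideanSpace.single 0 1) ∧ curl (v s) y 2 = 0) ∧
      (∀ y, curl (v s) y = cross (gradient ψ y) (EuclideanSpace.single 2 1)) ∧
      (∀ y, (Δ φ) y + fderiv ℝ ψ y (EuclideanSpace.single 2 1) = 0) ∧
      (∀ c : ℝ, φ (c • EuclideanSpace.single 2 1) = 0) := by
  have hV : ContDiff ℝ ∞ (v s) := contDiff_slice hrate hcont hmild hs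
  have hc2 : ∀ y, curl (v s) y 2 = 0 := fun y => curl_two_eq_zero hpol hs y
  obtain ⟨φ, ψ, hφ, hψ, h0, h1, h2, hvec, hcomp, hcross, hdiv', hax⟩ :=
    exists_potential_add_vertical hV hc2
  refine ⟨φ, ψ, hφ, hψ, h0, h1, h2, hvec, hcomp, hcross, fun y => ?_, hax⟩
  rw [← hdiv' y]
  exact hdiv s hs y

/-- Expansion of a directional derivative along the curl in coordinates:
`(DV·ω)₂ = ω₀ (DV e₀)₂ + ω₁ (DV e₁)₂ + ω₂ (DV e₂)₂`. -/
theorem fderiv_apply_curl_two (V : EuclideanSpace ℝ (Fin 3) → EuclideanSpace ℝ (Fin 3))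
    (y : EuclideanSpace ℝ (Fin 3)) :
    fderiv ℝ V y (curl V y) 2 =
      curl V y 0 * fderiv ℝ V y (EuclideanSpace.single 0 1) 2 +
        curl V y 1 * fderiv ℝ V y (EuclideanSpace.single 1 1) 2 +
        curl V y 2 * fderiv ℝ V y (EuclideanSpace.single 2 1) 2 := by
  rw [clm_apply_coord (fderiv ℝ V y) (curl V y) 2, Fin.sum_univ_three]

/-- **The frozen constraint in Clebsch form.** Under the hypotheses of `stub_nonflatLiouville` — in
particular the first integral `⟪D(v s) y · curl (v s) y, e₂⟫ = 0` (stub `stub_firstIntegral`, nsreg-p1 R8-b) —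
and for ANY `ψ` carrying the vorticity of the slice as `curl (v s) = (∂₁ψ, −∂₀ψ, 0)`, the planar Poisson
bracket of `ψ` and `v₂` vanishes: `∂₁ψ · ∂₀v₂ − ∂₀ψ · ∂₁v₂ = 0` at every point (`∇_h v₂ ∥ ∇_h ψ`: on each
horizontal plane the vertical velocity is constant along the vortex lines, the level curves of `ψ`). -/
theorem frozen_bracket {s : ℝ}
    (hfi : ∀ y, ⟪fderiv ℝ (v s) y (curl (v s) y), EuclideanSpace.single 2 1⟫_ℝ = 0)
    {ψ : EuclideanSpace ℝ (Fin 3) → ℝ}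
    (hψ : ∀ y, curl (v s) y 0 = fderiv ℝ ψ y (EuclideanSpace.single 1 1) ∧
      curl (v s) y 1 = -fderiv ℝ ψ y (EuclideanSpace.single 0 1) ∧ curl (v s) y 2 = 0)
    (y : EuclideanSpace ℝ (Fin 3)) :
    fderiv ℝ ψ y (EuclideanSpace.single 1 1) * fderiv ℝ (v s) y (EuclideanSpace.single 0 1) 2 -
      fderiv ℝ ψ y (EuclideanSpace.single 0 1) * fderiv ℝ (v s) y (EuclideanSpace.single 1 1) 2 = 0 := by
  have h := hfi y
  simp only [EuclideanSpace.inner_single_right, one_mul, conj_trivial] at h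
  rw [fderiv_apply_curl_two] at h
  obtain ⟨h0, h1, h2⟩ := hψ y
  rw [h0, h1, h2] at h
  linarith

/-- **The frozen constraint, vector form**: with `ψ` as above, the horizontal gradients of `v₂` and `ψ` are
parallel, stated as the vanishing of the `e₂`-component of `∇ψ × ∇v₂`-type determinant for the slice
potentials of `exists_clebsch_slice` (there `v₂ = ∂₂φ + ψ`). Packaged for the stub: for every `s < 0` there
are Clebsch potentials with (E1) and the bracket identity. -/
theorem exists_clebsch_slice_frozen (hrate : HasTypeITimeDecay C v)
    (hcont : ContinuousOn (uncurry v) (Iio (0 : ℝ) ×ˢ univ))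
    (hmild : ∀ s t : ℝ, s < t → t < 0 → ∀ x,
      v t x = UnboundedOperators.heatExtension (v s) (t - s) x - oseenDuhamel 1 s v v t x)
    (hdiv : ∀ t < 0, VectorCalculus.IsDivFree (v t))
    (hpol : ∀ s < 0, ∀ y, ⟪curl (v s) y, EuclideanSpace.single 2 1⟫_ℝ = 0)
    (hfi : ∀ s < 0, ∀ y, ⟪fderiv ℝ (v s) y (curl (v s) y), EuclideanSpace.single 2 1⟫_ℝ = 0)
    {s : ℝ} (hs : s < 0) :
    ∃ φ ψ : EuclideanSpace ℝ (Fin 3) → ℝ, ContDiff ℝ ∞ φ ∧ ContDiff ℝ ∞ ψ ∧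
      (∀ y, v s y = gradient φ y + ψ y • EuclideanSpace.single 2 1) ∧
      (∀ y, curl (v s) y = cross (gradient ψ y) (EuclideanSpace.single 2 1)) ∧
      (∀ y, (Δ φ) y + fderiv ℝ ψ y (EuclideanSpace.single 2 1) = 0) ∧
      (∀ y, fderiv ℝ ψ y (EuclideanSpace.single 1 1) * fderiv ℝ (v s) y (EuclideanSpace.single 0 1) 2 -
        fderiv ℝ ψ y (EuclideanSpace.single 0 1) * fderiv ℝ (v s) y (EuclideanSpace.single 1 1) 2 = 0) := by
  obtain ⟨φ, ψ, hφ, hψ, -, -, -, hvec, hcomp, hcross, hE1, -⟩ :=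
    exists_clebsch_slice hrate hcont hmild hdiv hpol hs
  exact ⟨φ, ψ, hφ, hψ, hvec, hcross, hE1, fun y => frozen_bracket (hfi s hs) hcomp y⟩


/-- **Time-dependent Clebsch potentials, jointly smooth on the slab.** Under the hypotheses of
`stub_nonflatLiouville` there are `φ ψ : ℝ → ℝ³ → ℝ`, jointly `C^∞` on `(−∞,0) × ℝ³`, with, for every `t < 0`:
`∂₀(φ t) = (v t)₀`, `∂₁(φ t) = (v t)₁`, `(v t)₂ = ∂₂(φ t) + ψ t`, `v t = ∇(φ t) + (ψ t) e₂`,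
`curl (v t) = ∇(ψ t) × e₂` (coordinates `(∂₁ψ, −∂₀ψ, 0)`) and (E1) `Δ(φ t) + ∂₂(ψ t) = 0`. (`φ t` is the horizontal
line potential of the slice `v t`; joint smoothness by `VerticalVorticityFree.contDiffOn_linePotential_uncurry` and,
for `ψ = v₂ − ∂₂φ`, by `IsSmoothSpaceTimeOn.fderiv_slice`.) -/
theorem exists_clebsch_uncurry (hrate : HasTypeITimeDecay C v)
    (hcont : ContinuousOn (uncurry v) (Iio (0 : ℝ) ×ˢ univ))
    (hmild : ∀ s t : ℝ, s < t → t < 0 → ∀ x,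
      v t x = UnboundedOperators.heatExtension (v s) (t - s) x - oseenDuhamel 1 s v v t x)
    (hdiv : ∀ t < 0, VectorCalculus.IsDivFree (v t))
    (hpol : ∀ s < 0, ∀ y, ⟪curl (v s) y, EuclideanSpace.single 2 1⟫_ℝ = 0) :
    ∃ φ ψ : ℝ → EuclideanSpace ℝ (Fin 3) → ℝ,
      ContDiffOn ℝ ∞ (uncurry φ) (Iio (0 : ℝ) ×ˢ univ) ∧ ContDiffOn ℝ ∞ (uncurry ψ) (Iio (0 : ℝ) ×ˢ univ) ∧
      ∀ t < 0,
        (∀ y, fderiv ℝ (φ t) y (EuclideanSpace.single 0 1) = v t y 0) ∧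
        (∀ y, fderiv ℝ (φ t) y (EuclideanSpace.single 1 1) = v t y 1) ∧
        (∀ y, v t y 2 = fderiv ℝ (φ t) y (EuclideanSpace.single 2 1) + ψ t y) ∧
        (∀ y, v t y = gradient (φ t) y + ψ t y • EuclideanSpace.single 2 1) ∧
        (∀ y, curl (v t) y 0 = fderiv ℝ (ψ t) y (EuclideanSpace.single 1 1) ∧
          curl (v t) y 1 = -fderiv ℝ (ψ t) y (EuclideanSpace.single 0 1) ∧ curl (v t) y 2 = 0) ∧
        (∀ y, (Δ (φ t)) y + fderiv ℝ (ψ t) y (EuclideanSpace.single 2 1) = 0) := by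
  -- joint smoothness of `v` on the slab (joint real-analyticity of Oseen-ancient fields)
  have hsm : ContDiffOn ℝ ∞ (uncurry v) (Iio (0 : ℝ) ×ˢ univ) :=
    (analyticOnNhd_uncurry hcont (bdd_of_hasTypeITimeDecay hrate) hmild).contDiffOn_of_completeSpace
  set φ : ℝ → EuclideanSpace ℝ (Fin 3) → ℝ := fun t x =>
    ∫ σ in (0 : ℝ)..1, ⟪v t (σ • (x - x 2 • (EuclideanSpace.single (2 : Fin 3) (1 : ℝ))) +
      x 2 • (EuclideanSpace.single (2 : Fin 3) (1 : ℝ))),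
      x - x 2 • (EuclideanSpace.single (2 : Fin 3) (1 : ℝ))⟫_ℝ with hφ
  set ψ : ℝ → EuclideanSpace ℝ (Fin 3) → ℝ := fun t y =>
    v t y 2 - fderiv ℝ (φ t) y (EuclideanSpace.single 2 1) with hψ
  have hφs : ContDiffOn ℝ ∞ (uncurry φ) (Iio (0 : ℝ) ×ˢ univ) := contDiffOn_linePotential_uncurry hsm
  have hDφ : IsSmoothSpaceTimeOn (Iio (0 : ℝ)) (fun t x => fderiv ℝ (φ t) x) :=
    IsSmoothSpaceTimeOn.fderiv_slice hφs (isOpen_Iio.uniqueDiffOn)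
  have hψs : ContDiffOn ℝ ∞ (uncurry ψ) (Iio (0 : ℝ) ×ˢ univ) := by
    have h1 : ContDiffOn ℝ ∞ (fun q : ℝ × EuclideanSpace ℝ (Fin 3) => (uncurry v) q 2) (Iio (0 : ℝ) ×ˢ univ) :=
      (EuclideanSpace.proj (2 : Fin 3) : EuclideanSpace ℝ (Fin 3) →L[ℝ] ℝ).contDiff.comp_contDiffOn hsm
    have h2 : ContDiffOn ℝ ∞ (fun q : ℝ × EuclideanSpace ℝ (Fin 3) =>
        (uncurry (fun t x => fderiv ℝ (φ t) x)) q (EuclideanSpace.single 2 1)) (Iio (0 : ℝ) ×ˢ univ) :=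
      ContDiffOn.clm_apply (show ContDiffOn ℝ ∞ (uncurry fun t x => fderiv ℝ (φ t) x)
        (Iio (0 : ℝ) ×ˢ univ) from hDφ) contDiffOn_const
    exact (h1.sub h2).congr fun q _ => by rcases q with ⟨t, y⟩; rfl
  refine ⟨φ, ψ, hφs, hψs, fun t ht => ?_⟩
  have hV : ContDiff ℝ ∞ (v t) := contDiff_slice hrate hcont hmild ht
  have hc2 : ∀ y, curl (v t) y 2 = 0 := fun y => curl_two_eq_zero hpol ht y
  have hφt : φ t = fun x : EuclideanSpace ℝ (Fin 3) =>
      ∫ σ in (0 : ℝ)..1, ⟪v t (σ • (x - x 2 • (EuclideanSpace.single (2 : Fin 3) (1 : ℝ))) +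
        x 2 • (EuclideanSpace.single (2 : Fin 3) (1 : ℝ))),
        x - x 2 • (EuclideanSpace.single (2 : Fin 3) (1 : ℝ))⟫_ℝ := rfl
  have h0 : ∀ y, fderiv ℝ (φ t) y (EuclideanSpace.single 0 1) = v t y 0 := fun y =>
    fderiv_linePotential_single hV hc2 y (Or.inl rfl)
  have h1 : ∀ y, fderiv ℝ (φ t) y (EuclideanSpace.single 1 1) = v t y 1 := fun y =>
    fderiv_linePotential_single hV hc2 y (Or.inr rfl)
  have h2 : ∀ y, v t y 2 = fderiv ℝ (φ t) y (EuclideanSpace.single 2 1) + ψ t y := fun y => by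
    simp only [hψ]; ring
  have hcomp : ∀ y, curl (v t) y 0 = fderiv ℝ (ψ t) y (EuclideanSpace.single 1 1) ∧
      curl (v t) y 1 = -fderiv ℝ (ψ t) y (EuclideanSpace.single 0 1) ∧ curl (v t) y 2 = 0 :=
    fun y => curl_apply_eq_fderiv_stream hV hc2 hφt y
  have hgrad : ∀ (f : EuclideanSpace ℝ (Fin 3) → ℝ) (x : EuclideanSpace ℝ (Fin 3)) (i : Fin 3),
      gradient f x i = fderiv ℝ f x (EuclideanSpace.single i 1) := by
    intro f x i
    have e : gradient f x i = ⟪gradient f x, EuclideanSpace.single i (1 : ℝ)⟫_ℝ := by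
      rw [EuclideanSpace.inner_single_right]; simp
    rw [e, gradient, InnerProductSpace.toDual_symm_apply]
  refine ⟨h0, h1, h2, fun y => ?_, hcomp, fun y => ?_⟩
  · ext i
    fin_cases i
    · simp [hgrad, h0]
    · simp [hgrad, h1]
    · simp [hgrad, h2 y]
  · rw [← divergence_eq_laplacian_add_fderiv_stream hV hc2 hφt y]
    exact hdiv t ht y

end Summit.NavierStokesRegularity.NavierStokesRegularity.Theorems.PoloidalWindowDoorPoloidalWindowRigidityClebsch

end
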